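import Summits.CriticalPhenomena.PercolationContinuityZ3.Theorems.PercNearOneGluingNoHeavyQuantLSCoreFlowB
import HarnessLib

/-!
# QUANT lane R8, T-DEC, binder (II) `ConvClosedTResidue`: FLOW LEMMA of the six-cell light-slice law, pattern LLG

builds on p205010 (kernel theorem, internal audit signed; external expert review pending)

Support file (`--supports stmt-CriticalPhenomena-4575`), QUANT lane seat prim-quant-census-1 (gen 22), rung R8 of
`run/shared/lean/prim/quant/LADDER.md`.  Memo `run/shared/lean/prim/quant/prim-quant-census-1/LSCORE-G22.md` §9.
Theorems only, standard axioms, no sorries.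

Companion of `…QuantLSCoreFlow` (pattern MMG) and `…QuantLSCoreFlowB` (pattern LMG).  Pattern LLG of the six-cell light-slice law
`c₁δ_{p+l} + c₂δ_{p+l′} + c_Pδ_{p+h} + d₁δ_{m+l} + d₂δ_{m+l′} + d_Gδ_{m+h}`: `2(m+l′) < T ≤ 2(p+h)`, so the four light cells
`p+l, p+l′, m+l, m+l′` are lows, the head cell `p+h ≤ j` is the only mid and `m+h > j` is the giant.  Eight flows (each low into the head
cell, positive only on a compatible pair, and the rests into the giant) with the two capacity inequalities give `DECAtT x T j M`
(`decAtT_of_flowAtT`).  The positions `p+l′` and `m+l` may coincide.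

* `LawDec.lsLaw_decAtT_of_flow_LLG` — the statement above.

[this work].  Nothing here is cited as a published result.  The gluing rows served [cite: KozmaNitzan2024, Conjecture 3 (p. 15)];
product measure [cite: Grimmett1999, §1.3 p. 10].
-/

noncomputable section

namespace Summit.CriticalPhenomena.PercolationContinuityZ3.Theorems

namespace Quant

open Finset

namespace LawDec

/-- **DEC OF THE SIX-CELL LIGHT-SLICE LAW FROM ITS FLOW, PATTERN LLG.**  Floor `0 < x < 1`, target `T`, layer `j`, top `M`; positions
`p < m`, `l < l′ < h` with `2(p+l′) < T` and `2(m+l′) < T` (four lows), `T ≤ 2(p+h)`, `p + h ≤ j` (the mid) and `j < m + h ≤ M` (the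
giant).  Masses `c₁, c₂, c_P, d₁, d₂, d_G` with sum `1` at `p+l, p+l′, p+h, m+l, m+l′, m+h`.  Flows `F₁, F₂, F₃, F₄ ≥ 0` from
`p+l, p+l′, m+l, m+l′` into `p+h`, each positive only when the pair is compatible (`T < lo + hi`) and at most the mass of its low (the
rests ride the giant).  If the head cell is not overloaded (`usage·F` sum `≤ c_P`) and `x/(1−x)·(rests) ≤ d_G`, the law is
`DECAtT x T j M`. [this work] -/
theorem lsLaw_decAtT_of_flow_LLG (x T c₁ c₂ cP d₁ d₂ dG F₁ F₂ F₃ F₄ : ℝ) (p m l l' h j M : ℕ)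
    (hx0 : 0 < x) (hx1 : x < 1)
    (hsum : c₁ + c₂ + cP + d₁ + d₂ + dG = 1)
    (hpm : p < m) (hll : l < l') (hlh : l' < h)
    (hlow : 2 * ((p : ℝ) + l') < T) (hlow2 : 2 * ((m : ℝ) + l') < T) (hmidP : T ≤ 2 * ((p : ℝ) + h))
    (hPj : p + h ≤ j) (hGj : j < m + h) (hGM : m + h ≤ M)
    (hF1 : 0 ≤ F₁) (hF2 : 0 ≤ F₂) (hF3 : 0 ≤ F₃) (hF4 : 0 ≤ F₄)
    (hF1c : 0 < F₁ → T < ((p + l : ℕ) : ℝ) + ((p + h : ℕ) : ℝ)) (hF2c : 0 < F₂ → T < ((p + l' : ℕ) : ℝ) + ((p + h : ℕ) : ℝ))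
    (hF3c : 0 < F₃ → T < ((m + l : ℕ) : ℝ) + ((p + h : ℕ) : ℝ)) (hF4c : 0 < F₄ → T < ((m + l' : ℕ) : ℝ) + ((p + h : ℕ) : ℝ))
    (hR1 : F₁ ≤ c₁) (hR2 : F₂ ≤ c₂) (hR3 : F₃ ≤ d₁) (hR4 : F₄ ≤ d₂)
    (hcapP : usage x T j (p + l) (p + h) * F₁ + usage x T j (p + l') (p + h) * F₂ + usage x T j (m + l) (p + h) * F₃
      + usage x T j (m + l') (p + h) * F₄ ≤ cP)
    (hcapG : x / (1 - x) * ((c₁ - F₁) + (c₂ - F₂) + (d₁ - F₃) + (d₂ - F₄)) ≤ dG) :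
    DECAtT x T j M (fun q => c₁ * (if q = p + l then (1:ℝ) else 0) + c₂ * (if q = p + l' then (1:ℝ) else 0)
      + cP * (if q = p + h then (1:ℝ) else 0) + d₁ * (if q = m + l then (1:ℝ) else 0)
      + d₂ * (if q = m + l' then (1:ℝ) else 0) + dG * (if q = m + h then (1:ℝ) else 0)) := by
  classical
  -- the leftovers riding the giant
  set R₁ : ℝ := c₁ - F₁ with hR₁
  set R₂ : ℝ := c₂ - F₂ with hR₂
  set R₃ : ℝ := d₁ - F₃ with hR₃
  set R₄ : ℝ := d₂ - F₄ with hR₄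
  have hR10 : 0 ≤ R₁ := by rw [hR₁]; linarith
  have hR20 : 0 ≤ R₂ := by rw [hR₂]; linarith
  have hR30 : 0 ≤ R₃ := by rw [hR₃]; linarith
  have hR40 : 0 ≤ R₄ := by rw [hR₄]; linarith
  -- names of the positions
  set a₁ : ℕ := p + l with ha₁
  set a₂ : ℕ := p + l' with ha₂
  set bP : ℕ := p + h with hbP
  set b₁ : ℕ := m + l with hb₁
  set b₂ : ℕ := m + l' with hb₂
  set bG : ℕ := m + h with hbG
  -- order facts (`a₂` and `b₁` may coincide or come in either order)
  have ha12 : a₁ < a₂ := by omega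
  have ha1b1 : a₁ < b₁ := by omega
  have hb12 : b₁ < b₂ := by omega
  have hbPG : bP < bG := by omega
  have ha2P : a₂ < bP := by omega
  have hb2P : b₂ < bP := by
    have : 2 * ((m : ℝ) + l') < 2 * ((p : ℝ) + h) := lt_of_lt_of_le hlow2 hmidP
    have : (m : ℝ) + l' < (p : ℝ) + h := by linarith
    exact_mod_cast (by exact_mod_cast this : m + l' < p + h)
  -- casts of positions
  have ca₁ : ((a₁ : ℕ) : ℝ) = (p : ℝ) + l := by rw [ha₁]; push_cast; ring
  have ca₂ : ((a₂ : ℕ) : ℝ) = (p : ℝ) + l' := by rw [ha₂]; push_cast; ring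
  have cbP : ((bP : ℕ) : ℝ) = (p : ℝ) + h := by rw [hbP]; push_cast; ring
  have cb₁ : ((b₁ : ℕ) : ℝ) = (m : ℝ) + l := by rw [hb₁]; push_cast; ring
  have cb₂ : ((b₂ : ℕ) : ℝ) = (m : ℝ) + l' := by rw [hb₂]; push_cast; ring
  have hll' : (l : ℝ) ≤ l' := by exact_mod_cast hll.le
  -- the four outgoing bundles and the flow
  set g : ℝ → ℝ → ℕ → ℝ := fun F R q => F * (if q = bP then (1:ℝ) else 0) + R * (if q = bG then (1:ℝ) else 0) with hg
  set f : ℕ → ℕ → ℝ := fun s q =>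
    (if s = a₁ then (1:ℝ) else 0) * g F₁ R₁ q + (if s = a₂ then (1:ℝ) else 0) * g F₂ R₂ q
    + (if s = b₁ then (1:ℝ) else 0) * g F₃ R₃ q + (if s = b₂ then (1:ℝ) else 0) * g F₄ R₄ q with hf
  have ind_nn : ∀ (P : Prop) [Decidable P], (0:ℝ) ≤ (if P then (1:ℝ) else 0) := fun P _ => by split_ifs <;> norm_num
  have hgn : ∀ (F R : ℝ) (q : ℕ), 0 ≤ F → 0 ≤ R → 0 ≤ g F R q := fun F R q hF hR => by
    have := ind_nn (q = bP); have := ind_nn (q = bG); simp only [hg]; positivity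
  -- the law vanishes above `M` and has mass `1`
  have hvan : ∀ q, M < q → c₁ * (if q = a₁ then (1:ℝ) else 0) + c₂ * (if q = a₂ then (1:ℝ) else 0)
      + cP * (if q = bP then (1:ℝ) else 0) + d₁ * (if q = b₁ then (1:ℝ) else 0)
      + d₂ * (if q = b₂ then (1:ℝ) else 0) + dG * (if q = bG then (1:ℝ) else 0) = 0 := by
    intro q hq
    rw [if_neg (by omega : q ≠ a₁), if_neg (by omega : q ≠ a₂), if_neg (by omega : q ≠ bP), if_neg (by omega : q ≠ b₁),
      if_neg (by omega : q ≠ b₂), if_neg (by omega : q ≠ bG)]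
    ring
  have hmass : ∑ q ∈ Finset.range (M + 1), (c₁ * (if q = a₁ then (1:ℝ) else 0) + c₂ * (if q = a₂ then (1:ℝ) else 0)
      + cP * (if q = bP then (1:ℝ) else 0) + d₁ * (if q = b₁ then (1:ℝ) else 0)
      + d₂ * (if q = b₂ then (1:ℝ) else 0) + dG * (if q = bG then (1:ℝ) else 0)) = 1 := by
    simp only [Finset.sum_add_distrib]
    rw [BlobDec2.sum_range_const_indicator _ a₁ (by omega), BlobDec2.sum_range_const_indicator _ a₂ (by omega),
      BlobDec2.sum_range_const_indicator _ bP (by omega), BlobDec2.sum_range_const_indicator _ b₁ (by omega),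
      BlobDec2.sum_range_const_indicator _ b₂ (by omega), BlobDec2.sum_range_const_indicator _ bG (by omega)]
    linarith
  refine decAtT_of_flowAtT x T j M _ hx0 hx1 hvan hmass ⟨f, ?_, ?_, ?_, ?_⟩
  · -- nonnegativity
    intro s q
    simp only [hf]
    have i1 := ind_nn (s = a₁); have i2 := ind_nn (s = a₂); have i3 := ind_nn (s = b₁); have i4 := ind_nn (s = b₂)
    have := hgn F₁ R₁ q hF1 hR10; have := hgn F₂ R₂ q hF2 hR20; have := hgn F₃ R₃ q hF3 hR30; have := hgn F₄ R₄ q hF4 hR40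
    positivity
  · -- support: only lows ship, only into compatible absorbers
    intro s q hpos
    simp only [hf] at hpos
    have hs : s = a₁ ∨ s = a₂ ∨ s = b₁ ∨ s = b₂ := by
      by_contra hne
      push Not at hne
      rw [if_neg hne.1, if_neg hne.2.1, if_neg hne.2.2.1, if_neg hne.2.2.2] at hpos
      simp at hpos
    have hslow : 2 * (s : ℝ) < T := by
      rcases hs with hs | hs | hs | hs
      · rw [hs, ca₁]; linarith
      · rw [hs, ca₂]; exact hlow
      · rw [hs, cb₁]; linarith
      · rw [hs, cb₂]; exact hlow2
    have hsj : s ≤ j := by rcases hs with hs | hs | hs | hs <;> omega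
    have hq : q = bP ∨ q = bG := by
      by_contra hne
      push Not at hne
      have z : ∀ (F R : ℝ), g F R q = 0 := by
        intro F R; simp only [hg]; rw [if_neg hne.1, if_neg hne.2]; ring
      simp only [z, mul_zero, add_zero] at hpos
      exact lt_irrefl _ hpos
    have hqM' : q ≤ M := by rcases hq with hq | hq <;> omega
    refine ⟨hsj, hslow, hqM', ?_⟩
    by_cases hqG : q = bG
    · exact Or.inl (by omega)
    · refine Or.inr ?_
      by_contra hT
      have zg : ∀ (F R : ℝ) (a : ℕ), 0 ≤ F → (0 < F → T < ((a : ℕ) : ℝ) + ((bP : ℕ) : ℝ)) →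
          (if s = a then (1:ℝ) else 0) * g F R q = 0 := by
        intro F R a hF hFc
        by_cases h1 : s = a
        · simp only [hg]
          rw [flow_term_eq_zero T F s bP q hF (fun hp => by rw [h1]; exact hFc hp) hT, if_neg hqG]; ring
        · rw [if_neg h1, zero_mul]
      rw [zg F₁ R₁ a₁ hF1 (fun hp => by rw [ha₁, hbP]; exact hF1c hp), zg F₂ R₂ a₂ hF2 (fun hp => by rw [ha₂, hbP]; exact hF2c hp),
        zg F₃ R₃ b₁ hF3 (fun hp => by rw [hb₁, hbP]; exact hF3c hp), zg F₄ R₄ b₂ hF4 (fun hp => by rw [hb₂, hbP]; exact hF4c hp)]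
        at hpos
      simp at hpos
  · -- every low is shipped exactly
    intro s hsj hslow
    have hI : ∀ k, k ≤ M → ∑ q ∈ Finset.range (M + 1), (if q = k then (1:ℝ) else 0) = 1 := by
      intro k hk
      rw [Finset.sum_ite_eq' (Finset.range (M + 1)) k (fun _ => (1:ℝ)), if_pos (Finset.mem_range.2 (by omega))]
    have hS : ∀ (F R : ℝ), ∑ q ∈ Finset.range (M + 1), g F R q = F + R := by
      intro F R
      simp only [hg, Finset.sum_add_distrib, ← Finset.mul_sum, hI bP (by omega), hI bG (by omega), mul_one]
    have hsum : ∑ q ∈ Finset.range (M + 1), f s q =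
        (if s = a₁ then (1:ℝ) else 0) * (F₁ + R₁) + (if s = a₂ then (1:ℝ) else 0) * (F₂ + R₂)
        + (if s = b₁ then (1:ℝ) else 0) * (F₃ + R₃) + (if s = b₂ then (1:ℝ) else 0) * (F₄ + R₄) := by
      simp only [hf, Finset.sum_add_distrib, ← Finset.mul_sum, hS]
    rw [hsum]
    have hsP : s ≠ bP := by rintro rfl; rw [cbP] at hslow; linarith
    have hsG : s ≠ bG := by omega
    dsimp only
    rw [if_neg hsP, if_neg hsG, hR₁, hR₂, hR₃, hR₄]
    ring
  · -- no absorber is overloaded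
    intro q hqM hself
    have hqa1 : q ≠ a₁ := by
      rintro rfl
      rcases hself with h1 | h1
      · omega
      · rw [ca₁] at h1; linarith
    have hqa2 : q ≠ a₂ := by
      rintro rfl
      rcases hself with h1 | h1
      · omega
      · rw [ca₂] at h1; linarith
    have hqb1 : q ≠ b₁ := by
      rintro rfl
      rcases hself with h1 | h1
      · omega
      · rw [cb₁] at h1; linarith
    have hqb2 : q ≠ b₂ := by
      rintro rfl
      rcases hself with h1 | h1
      · omega
      · rw [cb₂] at h1; linarith
    have e : ∀ s, usage x T j s q * f s q = (if s = a₁ then (1:ℝ) else 0) * (usage x T j s q * g F₁ R₁ q)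
        + (if s = a₂ then (1:ℝ) else 0) * (usage x T j s q * g F₂ R₂ q) + (if s = b₁ then (1:ℝ) else 0) * (usage x T j s q * g F₃ R₃ q)
        + (if s = b₂ then (1:ℝ) else 0) * (usage x T j s q * g F₄ R₄ q) := by
      intro s; simp only [hf]; ring
    have hsumq : ∑ s ∈ Finset.range (j + 1), usage x T j s q * f s q
        = usage x T j a₁ q * g F₁ R₁ q + usage x T j a₂ q * g F₂ R₂ q + usage x T j b₁ q * g F₃ R₃ q
          + usage x T j b₂ q * g F₄ R₄ q := by
      rw [Finset.sum_congr rfl (fun s _ => e s), Finset.sum_add_distrib, Finset.sum_add_distrib, Finset.sum_add_distrib,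
        sum_indicator_mul_eq j a₁ (fun s => usage x T j s q * g F₁ R₁ q) (by omega),
        sum_indicator_mul_eq j a₂ (fun s => usage x T j s q * g F₂ R₂ q) (by omega),
        sum_indicator_mul_eq j b₁ (fun s => usage x T j s q * g F₃ R₃ q) (by omega),
        sum_indicator_mul_eq j b₂ (fun s => usage x T j s q * g F₄ R₄ q) (by omega)]
    rw [hsumq]
    dsimp only
    rw [if_neg hqa1, if_neg hqa2, if_neg hqb1, if_neg hqb2]
    simp only [hg]
    by_cases hqG : q = bG
    · -- the giant
      rw [if_pos hqG, if_neg (by omega : q ≠ bP)]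
      simp only [mul_one, mul_zero, add_zero, zero_add]
      have hgq : j + 1 ≤ q := by omega
      rw [usage_giant_eq x T j a₁ q hgq, usage_giant_eq x T j a₂ q hgq, usage_giant_eq x T j b₁ q hgq,
        usage_giant_eq x T j b₂ q hgq]
      have : x / (1 - x) * R₁ + x / (1 - x) * R₂ + x / (1 - x) * R₃ + x / (1 - x) * R₄ ≤ dG := by
        rw [← mul_add, ← mul_add, ← mul_add]; exact hcapG
      linarith
    · rw [if_neg hqG]
      by_cases hqP : q = bP
      · rw [if_pos hqP]
        simp only [mul_one, mul_zero, add_zero]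
        have hcP' : usage x T j a₁ q * F₁ + usage x T j a₂ q * F₂ + usage x T j b₁ q * F₃ + usage x T j b₂ q * F₄ ≤ cP := by
          rw [hqP]; exact hcapP
        linarith
      · rw [if_neg hqP]
        simp only [mul_zero, add_zero]
        rfl

end LawDec

end Quant

end Summit.CriticalPhenomena.PercolationContinuityZ3.Theorems
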